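/-
Copyright (c) 2026 the pub-hodgecm-mathlib formalisation cell (harness21).  Prover seat hodgecm-mathlib-LH7-p04 (g12), 2026-09-03.
Road M6 → F3 «TOT-Λ BY OVER-ORDERS» (LEAD F0P3a-plan (g16) T14-66; sigsheets SIG-F3-5 v1 6925585c ∕ SIG-F3-5b-III v1 5a0aa3cf, F3-5 pen by (α)-lineage), brick F3-5b-III-γ «THE (W1) `hT` HEAD».
-/
import Literature.NumberTheory.Automorphic.SelfDualStableLatticeCountBlockFrame   -- ★-to-be F3-5b-III-β (this seat): `ncard_isSelfDualLattice_stable_eq_phiTHn_blockFrame ∕ _phiTHprimen_blockFrame`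
import Literature.NumberTheory.Automorphic.TypeTwoPairStarPolynomial            -- ★ D′γ (LH4-p01 (g10)) p853235: `exists_typeTwoOrder_of_eisensteinData_of_starPoly`
import HarnessLib

/-!
# The self-dual lattices stable under a type-(2) pair, counted from its Eisenstein data: ★ (W1)'s `hT` binder, class I `= Φ(t)` and class II `= Φ′(t″)`

Topic `NumberTheory/Automorphic`; namespace `Literature.NumberTheory.Automorphic`.  THEOREMS ONLY (no definition, no instance, no notation, no named fact, no `sorry`).
Cell `pub/hodgecm-mathlib` (D-0151), crux H413 = `stmt-HodgeConjecture-24833`; road M6 → F3 «TOT-Λ by over-orders», brick **F3-5b-III-γ** = SIG-F3-5 v1 §0 ∕ SIG-F3-5b-III v1 §0: the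
`hT`-SHAPED head of ★ (W1) `SelfDualLatticeFixOrderOnly.ncard_vertex_rowZero_eq_of_total` — for a pair `(g, u)` with EISENSTEIN DATA `Θ = α•1 + β•g`, `|det Θ| = |ϖ|`, `|tr Θ| < 1`,
`u•1 − g = a•1 + b•Θ`, `|det(u•1 − g)| = |ϖ|^n`, `|b| = |ϖ|^N` (★ (W1)'s `Valued` letters), the number of self-dual lattices (TREE currency, `IsSelfDualLattice σ ϖ J`) stable under the
block frame `φ(g, u) = c·[g ⊕ u]·c⁻¹` is `phiTHn q n N` (class I) ∕ `phiTHprimen q n N` (class II), `q = #𝓀_F`.  PROOF = ★ D′γ (the type-(2) order `𝒪_E[(u, λ)] = G(N, n, ιO y)` at a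
monogenic level from the data and a ⋆-POLYNOMIAL `P` with `P(u, λ) = (σu, s′λ)`, integral — ★ D′β supplies it at a unitary pair AND at every shift `ϖ⁻¹(x − 1)`, so F5's `hCg′` of ★ (W1)
is ★ `exists_starPoly_shift`) fed to ★ F3-5b-III-β.  BINDERS that F5 instantiates at the place: the abstract valued∕integral frame (★ (c5-ii) FILE A's 30 letters + `Valued` letters), the
form (`J hJ hJh hL₀ htrans`), the block frame and its endoscopic presentation (`cfr φ hφb`; `φ′ hφ′inj hφx hK hall hstar hcoordlam` = ★ FILE B's conclusions at the unitary pair,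
reused verbatim at its shifts), the row-agnostic `Valued`∕Krylov gate `hgateV` (★ C8-odd ∕ C8-unit), the class token at the frame vector `x₀ = c·e₂`.
HONEST LABEL: HC_CM is proved only modulo the 2 remaining named inputs (hLiu418 24832, h413 24833) until rung 0 closes; assembly of ★ bricks, asserts nothing printed; count-neutral
(pays no organ; zero label movement until F5 ★ and a desk-priced rider).

* **`ncard_isSelfDualLattice_stable_eq_phiTHn_of_eisensteinData`** (class I), **`ncard_isSelfDualLattice_stable_eq_phiTHprimen_of_eisensteinData`** (class II).

## References
* [Rogawski1990] J. D. Rogawski, *Automorphic Representations of Unitary Groups in Three Variables*, Ann. of Math. Stud. 123 (1990): §4.9 Lemma 4.9.3 p. 56, Prop. 4.9.1 (b) p. 55.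
* [Kottwitz1986BaseChangeUnits] R. E. Kottwitz, *Base change for unit elements of Hecke algebras*, Compositio Math. 60 (1986): §1 pp. 240–241, §3 (stable self-dual lattices and the shift).
* [Flicker1998UnitaryFL] Y. Z. Flicker, *Elementary proof of the fundamental lemma for a unitary group*, Canad. J. Math. 50 (1998): Props. 7, 11, 16–17, Theorem 18 p. 97.
* [Jacobowitz1962] R. Jacobowitz, *Hermitian forms over local fields*, Amer. J. Math. 84 (1962): §7.
-/

set_option autoImplicit false

noncomputable section

open Matrix Polynomial
open scoped MatrixGroups ValuativeRel Pointwise WithZero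

namespace Literature.NumberTheory.Automorphic

open Literature.NumberTheory.Automorphic.UnitaryGroup ValuativeRel Literature.NumberTheory.Rogawski1990 Literature.NumberTheory.Rogawski1990.Flicker1998
  Literature.NumberTheory.Automorphic.UnitaryLatticeTree Literature.NumberTheory.Automorphic.HermitianLattice

variable {F E : Type*} [Field F] [ValuativeRel F] [Field E] [Valued E ℤᵐ⁰] [ValuativeRel E] [(Valued.v : Valuation E ℤᵐ⁰).Compatible]
  (σ : E →+* E) {K : Type*} [Field K] [Valued K ℤᵐ⁰] [ValuativeRel K] [(Valued.v : Valuation K ℤᵐ⁰).Compatible] [Algebra E K] (σK : K →+* K)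
  -- the endoscopic ∕ integral ∕ Eisenstein frame (★ F3-5b-III-β's letters)
  (hσσ : ∀ x, σ (σ x) = x) (hσK : ∀ x, σK (σK x) = x) (hσO : ∀ x : 𝒪[E], σ x ∈ 𝒪[E]) (hK2 : Module.finrank E K = 2)
  (J : GL (Fin 3) E) (hJ : J ∈ glInt 3 E) (hJh : ((J : Matrix (Fin 3) (Fin 3) E).map σ)ᵀ = J)
  (cfr : GL (Fin 3) E) (φ : (E × K) →ₐ[E] Matrix (Fin 3) (Fin 3) E) (hφ : Function.Injective φ)
  (hstar : ∀ b : E × K, (J : Matrix (Fin 3) (Fin 3) E) * φ (RingHom.prodMap σ σK b) = ((φ b).map σ)ᵀ * J)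
  (hOK : ∀ r : 𝒪[E], algebraMap E K (r : E) ∈ 𝒪[K]) (hσKE : ∀ x : E, σK (algebraMap E K x) = algebraMap E K (σ x))
  (jO : 𝒪[E] →+* 𝒪[K]) (hjO : ∀ x : 𝒪[E], ((jO x : 𝒪[K]) : K) = algebraMap E K x)
  (σO : 𝒪[E] →+* 𝒪[E]) (hσO' : ∀ x : 𝒪[E], ((σO x : 𝒪[E]) : E) = σ x)
  (σKO : 𝒪[K] →+* 𝒪[K]) (hσKO : ∀ z : 𝒪[K], ((σKO z : 𝒪[K]) : K) = σK z)
  (hσv : ∀ x, valuation E (σ x) = valuation E x) (hσKv : ∀ z, valuation K (σK z) = valuation K z)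
  (ιO : 𝒪[F] →+* 𝒪[E]) (θ : 𝒪[K]) {aF k₀F : 𝒪[F]}
  (hσι : ∀ y, σO (ιO y) = ιO y) (hfixO : ∀ x, σO x = x → ∃ y, ιO y = x) (hιinj : Function.Injective ιO) (hιu : ∀ y, IsUnit (ιO y) → IsUnit y)
  (htr : ∃ b₀ : 𝒪[E], b₀ + σO b₀ = 1)
  (hσ₁j : ∀ x, σKO (jO x) = jO (σO x)) (hσ₁θ : σKO θ = θ)
  (hθ : θ ^ 2 = jO (ιO aF) * θ + jO (ιO k₀F)) (haF : aF ∈ IsLocalRing.maximalIdeal 𝒪[F]) (hk₀ : k₀F ∈ IsLocalRing.maximalIdeal 𝒪[F])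
  (hcoord : ∀ z : 𝒪[K], ∃! bc : 𝒪[E] × 𝒪[E], z = jO bc.1 + jO bc.2 * θ)
  (hnormE : ∀ b : 𝒪[E], IsUnit b → σO b = b → ∃ c : 𝒪[E], c * σO c = b) (hnorm₁ : ∀ z : 𝒪[K], IsUnit z → σKO z = z → ∃ w : 𝒪[K], w * σKO w = z)
  {ϖF : F} {ϖ : E} (hϖF : IsUniformizingElement ϖF) (hϖ : IsUniformizingElement ϖ) (hιϖ : ιO ⟨ϖF, hϖF.mem⟩ = ⟨ϖ, hϖ.mem⟩)
  (hk₁ : valuation E ((ιO k₀F : 𝒪[E]) : E) = valuation E ϖ) (hq : Nat.card 𝓀[E] = Nat.card 𝓀[F] ^ 2)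
  {ξ : 𝒪[E]} (hξ : IsUnit (ξ - σO ξ))
  (hnormEb : ∀ b : ℕ, 1 ≤ b → ∀ r : 𝒪[E], σO r = r → r - 1 ∈ Ideal.span ({(⟨ϖ, hϖ.mem⟩ : 𝒪[E]) ^ b} : Set 𝒪[E]) →
    ∃ w : 𝒪[E], w - 1 ∈ Ideal.span ({(⟨ϖ, hϖ.mem⟩ : 𝒪[E]) ^ b} : Set 𝒪[E]) ∧ w * σO w = r)
  (hσvV : ∀ x, Valued.v (σ x) = Valued.v x) (hjv : ∀ y : E, Valued.v (algebraMap E K y) = Valued.v y ^ 2)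
  (hθv : Valued.v (θ : K) = WithZero.exp (-1 : ℤ)) (hϖv : Valued.v ϖ = WithZero.exp (-1 : ℤ))
  (hcoordK : ∀ z : K, ∃! pq : E × E, z = algebraMap E K pq.1 + algebraMap E K pq.2 * (θ : K))
  (hnormK : ∀ x c : K, c ≠ 0 → σK c = c → Valued.v (x * σK x) = Valued.v c → ∃ t : K, t * σK t = c)
  (hL₀ : IsSelfDualLattice σ ϖ (J : Matrix (Fin 3) (Fin 3) E) (stdLattice E 3))
  (htrans : ∀ M : Submodule (Valued.integer E) (Fin 3 → E), IsSelfDualLattice σ ϖ (J : Matrix (Fin 3) (Fin 3) E) M →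
    ∃ u : ↥(unitaryGroupOfForm σ (J : Matrix (Fin 3) (Fin 3) E)), M = mapGL ((u : ↥(unitaryGroupOfForm σ (J : Matrix (Fin 3) (Fin 3) E))) : GL (Fin 3) E) (stdLattice E 3))
  -- the block frame and its endoscopic presentation at the pair `(g, u)` (★ FILE B's conclusions, valid at every shift of a unitary pair)
  (φb : (Matrix (Fin 2) (Fin 2) E × E) →ₐ[E] Matrix (Fin 3) (Fin 3) E)
  (hφb : ∀ (g : Matrix (Fin 2) (Fin 2) E) (u : E),
    φb (g, u) = (cfr : Matrix (Fin 3) (Fin 3) E) * Matrix.reindex endoPerm endoPerm (Matrix.fromBlocks g 0 0 (u • (1 : Matrix (Fin 1) (Fin 1) E))) *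
      ((cfr⁻¹ : GL (Fin 3) E) : Matrix (Fin 3) (Fin 3) E))
  {g Θ : Matrix (Fin 2) (Fin 2) E} {u α β a b : E} {n N : ℕ}
  (hg : ∀ i j, g i j ∈ 𝒪[E]) (hu : u ∈ 𝒪[E]) (h10 : g 1 0 ≠ 0) (hirr : ∀ x : E, x * x - g.trace * x + g.det ≠ 0)
  (hΘ : Θ = α • 1 + β • g) (hΘd : Valued.v Θ.det = Valued.v ϖ) (hΘt : Valued.v Θ.trace < 1)
  (hrel : u • (1 : Matrix (Fin 2) (Fin 2) E) - g = a • 1 + b • Θ)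
  (hn : Valued.v (u • (1 : Matrix (Fin 2) (Fin 2) E) - g).det = Valued.v ϖ ^ n) (hb : Valued.v b = Valued.v ϖ ^ N)
  {lam : K} (hlam : lam ^ 2 - algebraMap E K g.trace * lam + algebraMap E K g.det = 0) (hφx : φ ((u, lam) : E × K) = φb (g, u))
  (hK : IsUnit (Matrix.of fun i j : Fin 3 => (((φb (g, u)) ^ (j : ℕ)) *ᵥ ((cfr : Matrix (Fin 3) (Fin 3) E) *ᵥ
    (Pi.single (endoPerm (Sum.inl 0)) (1 : E) + Pi.single (endoPerm (Sum.inr 0)) (1 : E)))) i).det)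
  (hall : ∀ x : E × K, ∃ Q : E[X], aeval ((u, lam) : E × K) Q = x) (hcoordlam : ∀ z : K, ∃ p q : E, z = algebraMap E K p + algebraMap E K q * lam)
  -- the ⋆-polynomial of the pair (★ D′β `exists_starPoly_of_unitary ∕ exists_starPoly_shift`)
  (P : E[X]) (hP : ∀ i, P.coeff i ∈ 𝒪[E]) (hPx : aeval ((u, lam) : E × K) P = (σ u, σK lam))
  -- THE GATE in `Valued`∕Krylov currency (★ C8-odd `gate_at_generator_uniform` ∕ ★ C8-unit `gate_at_generator_wildUnit`)
  (hgateV : ∀ (u' p' q' t' D' : E) (N'' b : ℕ),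
    ((u', algebraMap E K p' + algebraMap E K q' * (θ : K)) : E × K) * RingHom.prodMap σ σK ((u', algebraMap E K p' + algebraMap E K q' * (θ : K)) : E × K) = 1 →
    Valued.v (u' - 1) < 1 → Valued.v (p' - 1) < 1 → Valued.v q' = WithZero.exp (-(N'' : ℤ)) →
    (algebraMap E K p' + algebraMap E K q' * (θ : K)) ^ 2 - algebraMap E K t' * (algebraMap E K p' + algebraMap E K q' * (θ : K)) + algebraMap E K D' = 0 →
    Valued.v (u' * u' - t' * u' + D') = WithZero.exp (-(b : ℤ)) →
    ((∃ w : Fin 3 → E, ∃ g₁ ∈ unitaryGroupOfForm σ (J : Matrix (Fin 3) (Fin 3) E),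
      Submodule.span 𝒪[E] (Set.range fun k : Fin 3 =>
        ((φ ((u', algebraMap E K p' + algebraMap E K q' * (θ : K)) : E × K)) ^ (k : ℕ)) *ᵥ w) =
        Submodule.span 𝒪[E] (Set.range ((g₁ : Matrix (Fin 3) (Fin 3) E))ᵀ)) ↔
    Even (WithZero.log (Valued.v (∑ k, ∑ i, σ (((cfr : Matrix (Fin 3) (Fin 3) E) *ᵥ Pi.single (endoPerm (Sum.inr 0)) (1 : E)) i) *
      (J : Matrix (Fin 3) (Fin 3) E) i k * ((cfr : Matrix (Fin 3) (Fin 3) E) *ᵥ Pi.single (endoPerm (Sum.inr 0)) (1 : E)) k)) + b)))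

include hσσ hσK hσO hK2 hJ hJh hφ hstar hOK hσKE hjO hσO' hσKO hσv hσKv hσι hfixO hιinj hιu htr hσ₁j hσ₁θ hθ haF hk₀ hcoord hnormE hnorm₁ hιϖ hk₁ hq hξ hnormEb
  hσvV hjv hθv hϖv hcoordK hnormK hL₀ htrans hφb hg hu h10 hirr hΘ hΘd hΘt hrel hn hb hlam hφx hK hall hcoordlam hP hPx hgateV in
/-- **★ (W1)'s `hT`, CLASS I: `#{M | IsSelfDualLattice σ ϖ J M ∧ φ(g,u)·M ⊆ M} = Φ(t) = phiTHn q n N`** for a pair `(g, u)` with Eisenstein data `(Θ, α, β, a, b, n, N)` in ★ (W1)'s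
`Valued` letters, a root `λ ∈ K` of `χ_g`, an integral ⋆-polynomial `P(u, λ) = (σu, s′λ)` and the class-I frame vector.  ★ D′γ + ★ F3-5b-III-β.
[cite: Rogawski1990, §4.9 Lemma 4.9.3 p. 56, Prop. 4.9.1 (b) p. 55] [cite: Kottwitz1986BaseChangeUnits, §1 pp. 240–241; §3] [cite: Flicker1998UnitaryFL, Prop. 11 p. 87; Theorem 18 p. 97] -/
theorem ncard_isSelfDualLattice_stable_eq_phiTHn_of_eisensteinData [Finite 𝓀[F]] [Finite 𝓀[E]] [IsDiscreteValuationRing 𝒪[E]] [IsDiscreteValuationRing 𝒪[F]]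
    (hI : ∃ c : E, c ≠ 0 ∧ valuation E (σ c * c *
      dotProduct (fun i => σ (((cfr : Matrix (Fin 3) (Fin 3) E) *ᵥ Pi.single (endoPerm (Sum.inr 0)) (1 : E)) i))
        ((J : Matrix (Fin 3) (Fin 3) E) *ᵥ ((cfr : Matrix (Fin 3) (Fin 3) E) *ᵥ Pi.single (endoPerm (Sum.inr 0)) (1 : E)))) = 1) :
    (({M : Submodule (Valued.integer E) (Fin 3 → E) | IsSelfDualLattice σ ϖ (J : Matrix (Fin 3) (Fin 3) E) M ∧
        M.map ((Matrix.toLin' (φb (g, u))).restrictScalars (Valued.integer E)) ≤ M}.ncard : ℕ) : ℚ) = phiTHn (Nat.card 𝓀[F]) n N := by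
  -- ★ (W1)'s `Valued` letters in `valuation` currency
  have hval : ∀ x : E, valuation K (algebraMap E K x) ≤ 1 ↔ valuation E x ≤ 1 := fun x => by
    rw [← v_le_one_iff_valuation_le_one, ← v_le_one_iff_valuation_le_one, hjv, pow_le_one_iff two_ne_zero]
  have hσσO : ∀ x, σO (σO x) = x := fun x => Subtype.ext (by rw [hσO', hσO', hσσ])
  have hΘd' : valuation E Θ.det = valuation E ϖ := (v_eq_iff_valuation_eq _ _).1 hΘd
  have hΘt' : valuation E Θ.trace < 1 := (v_lt_one_iff_valuation_lt_one _).1 hΘt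
  have hn' : valuation E (u • (1 : Matrix (Fin 2) (Fin 2) E) - g).det = valuation E ϖ ^ n := by
    rw [← map_pow]; exact (v_eq_iff_valuation_eq _ _).1 (by rw [map_pow]; exact hn)
  have hb' : valuation E b = valuation E ϖ ^ N := by
    rw [← map_pow]; exact (v_eq_iff_valuation_eq _ _).1 (by rw [map_pow]; exact hb)
  -- ★ D′γ: the type-(2) order at a monogenic level
  obtain ⟨uO, pO, qO, tO, DO, y, huO, -, -, hLcoe, -, -, -, -, hR, hlvl⟩ :=
    exists_typeTwoOrder_of_eisensteinData_of_starPoly hval ιO σO jO σKO θ σ σK hjO hσO' hσKO hσσO hσι hfixO hιu hσ₁j hσ₁θ hθ haF hcoord htr hϖF hϖ hιϖ hk₁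
      hg hu h10 hΘ hΘd' hΘt' hrel hn' hb' hlam P hP hPx
  have hxR : RingHom.prodMap (𝒪[E]).subtype (𝒪[K]).subtype ((uO, jO pO + jO qO * θ) : 𝒪[E] × 𝒪[K]) = ((u, lam) : E × K) := Prod.ext huO hLcoe
  -- ★ F3-5b-III-β at `τ := φ(g, u) = φ′(u, λ)`
  exact ncard_isSelfDualLattice_stable_eq_phiTHn_blockFrame σ σK hσσ hσK hσO hK2 J hJ hJh cfr (φb (g, u)) hK φ hφ ((u, lam) : E × K) hφx hstar hOK hσKE jO hjO σO hσO'
    σKO hσKO hσv hσKv ιO θ hσι hfixO hιinj hιu htr hσ₁j hσ₁θ hθ haF hk₀ hcoord hnormE hnorm₁ hϖF hϖ hιϖ hk₁ hq hξ hnormEb hσvV hjv hθv hϖv hcoordK hnormK hL₀ htrans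
    _ hxR hR hlvl φb hφb g u hirr hlam hφx hall hcoordlam hgateV hI

include hσσ hσK hσO hK2 hJ hJh hφ hstar hOK hσKE hjO hσO' hσKO hσv hσKv hσι hfixO hιinj hιu htr hσ₁j hσ₁θ hθ haF hk₀ hcoord hnormE hnorm₁ hιϖ hk₁ hq hξ hnormEb
  hσvV hjv hϖv hcoordK hL₀ htrans hφb hg hu h10 hirr hΘ hΘd hΘt hrel hn hb hlam hφx hK hall hcoordlam hP hPx hgateV in
/-- **★ (W1)'s `hT`, CLASS II: `#{M | IsSelfDualLattice σ ϖ J M ∧ φ(g,u)·M ⊆ M} = Φ′(t″) = phiTHprimen q n N`** (class II frame vector).  ★ D′γ + ★ F3-5b-III-β.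
[cite: Rogawski1990, §4.9 Lemma 4.9.3 p. 56, Prop. 4.9.1 (b) p. 55] [cite: Kottwitz1986BaseChangeUnits, §1 pp. 240–241; §3] [cite: Flicker1998UnitaryFL, Props. 16–17 pp. 96–97; Theorem 18 p. 97] -/
theorem ncard_isSelfDualLattice_stable_eq_phiTHprimen_of_eisensteinData [Finite 𝓀[F]] [Finite 𝓀[E]] [IsDiscreteValuationRing 𝒪[E]] [IsDiscreteValuationRing 𝒪[F]]
    (hII : ∀ c : E, c ≠ 0 → valuation E (σ c * c *
      dotProduct (fun i => σ (((cfr : Matrix (Fin 3) (Fin 3) E) *ᵥ Pi.single (endoPerm (Sum.inr 0)) (1 : E)) i))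
        ((J : Matrix (Fin 3) (Fin 3) E) *ᵥ ((cfr : Matrix (Fin 3) (Fin 3) E) *ᵥ Pi.single (endoPerm (Sum.inr 0)) (1 : E)))) ≠ 1) :
    (({M : Submodule (Valued.integer E) (Fin 3 → E) | IsSelfDualLattice σ ϖ (J : Matrix (Fin 3) (Fin 3) E) M ∧
        M.map ((Matrix.toLin' (φb (g, u))).restrictScalars (Valued.integer E)) ≤ M}.ncard : ℕ) : ℚ) = phiTHprimen (Nat.card 𝓀[F]) n N := by
  have hval : ∀ x : E, valuation K (algebraMap E K x) ≤ 1 ↔ valuation E x ≤ 1 := fun x => by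
    rw [← v_le_one_iff_valuation_le_one, ← v_le_one_iff_valuation_le_one, hjv, pow_le_one_iff two_ne_zero]
  have hσσO : ∀ x, σO (σO x) = x := fun x => Subtype.ext (by rw [hσO', hσO', hσσ])
  have hΘd' : valuation E Θ.det = valuation E ϖ := (v_eq_iff_valuation_eq _ _).1 hΘd
  have hΘt' : valuation E Θ.trace < 1 := (v_lt_one_iff_valuation_lt_one _).1 hΘt
  have hn' : valuation E (u • (1 : Matrix (Fin 2) (Fin 2) E) - g).det = valuation E ϖ ^ n := by
    rw [← map_pow]; exact (v_eq_iff_valuation_eq _ _).1 (by rw [map_pow]; exact hn)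
  have hb' : valuation E b = valuation E ϖ ^ N := by
    rw [← map_pow]; exact (v_eq_iff_valuation_eq _ _).1 (by rw [map_pow]; exact hb)
  obtain ⟨uO, pO, qO, tO, DO, y, huO, -, -, hLcoe, -, -, -, -, hR, hlvl⟩ :=
    exists_typeTwoOrder_of_eisensteinData_of_starPoly hval ιO σO jO σKO θ σ σK hjO hσO' hσKO hσσO hσι hfixO hιu hσ₁j hσ₁θ hθ haF hcoord htr hϖF hϖ hιϖ hk₁
      hg hu h10 hΘ hΘd' hΘt' hrel hn' hb' hlam P hP hPx
  have hxR : RingHom.prodMap (𝒪[E]).subtype (𝒪[K]).subtype ((uO, jO pO + jO qO * θ) : 𝒪[E] × 𝒪[K]) = ((u, lam) : E × K) := Prod.ext huO hLcoe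
  exact ncard_isSelfDualLattice_stable_eq_phiTHprimen_blockFrame σ σK hσσ hσK hσO hK2 J hJ hJh cfr (φb (g, u)) hK φ hφ ((u, lam) : E × K) hφx hstar hOK hσKE jO hjO σO hσO'
    σKO hσKO hσv hσKv ιO θ hσι hfixO hιinj hιu htr hσ₁j hσ₁θ hθ haF hk₀ hcoord hnormE hnorm₁ hϖF hϖ hιϖ hk₁ hq hξ hnormEb hσvV hϖv hcoordK hL₀ htrans
    _ hxR hR hlvl φb hφb g u hirr hlam hφx hall hcoordlam hgateV hII

end Literature.NumberTheory.Automorphic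

end
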